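import Literature.Computability.Cryptography.RegevGIVPPost
import Literature.Computability.Complexity.ZerosPrefixBricks
import HarnessLib

/-!
# Regev 2009, Lemma 3.17 at machine level, II: the query map of the `GIVP ≤ DGS` machine (`FP`)

Topic `Computability/Cryptography` (family `pqc`), grouping namespace `Regev2009.GIVPQuery`;
sequel of `RegevGIVPPost.lean`. Inside the `j`-th indexed copy (`QuantumComplexity/PolyCopiesIdx.lean`:
block `j` receives `⟨encode I, ε⟩ ++ e_j = ⟨encode I, e_j⟩`, `e_j` the one-hot index) the given
`DGS` sampler must be fed the code of the pair `(B, rᵢ)` with Regev's radius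
`rᵢ = R 2^{-i}` (proof of **Lemma 3.17**: *"apply the LLL algorithm to obtain `n` linearly
independent vectors of length at most `2ⁿ λₙ(L)` … let `λ̃ₙ` denote the [largest] length … call the
`DGS` oracle `n²` times with the pair `(L, rᵢ)` where `rᵢ = λ̃ₙ 2^{-i}`"*), `i = j / n²` (group
`i` = copies `i n², …, i n² + n² - 1`). The machine uses the power of two `R = 2ᵏ`,
`k = ⌈|bin M| / 2⌉` for the largest SQUARED norm `M` of the LLL basis, so that `λ̃ₙ < R ≤ 2 λ̃ₙ`
(`lt_two_pow_radiusExp`, `four_pow_radiusExp_le`; the tree's radius search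
`RegevRadiusSearch.lean` is stated for any such scale) and every radius is an exact rational whose
reduced fraction is immediate (`radius_num_den`). This file writes the QUERY MAP
`⟨encode I, e⟩ ↦ GapSVPInstance.encode (I, 2ᵏ / 2ⁱ)`, `i = leadingZeros e / n²`, as ONE
polynomial-time string function (`queryStr_codeFP`, `exists_queryFn`) in the typed `FP` algebra
`CodeFP` (the index is read in unary by `zerosPrefixFn`, `ZerosPrefixBricks.lean`; the largest
squared norm by `RowSelectFP.maxNormSq_codeFP`; the powers by `natPow` with unary exponents capped
by the lengths at hand).

## References

* O. Regev, *On lattices, learning with errors, random linear codes, and cryptography*, J. ACM 56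
  (2009), art. 34, Lemma 3.17 (proof, p. 21 of arXiv:2401.03703) [Regev2009].
* [AroraBarak2009] S. Arora, B. Barak, *Computational Complexity: A Modern Approach*, CUP 2009, §1.3.
-/

noncomputable section

namespace Literature.Computability.Cryptography

namespace Regev2009.GIVPQuery

open _root_.Computability Polynomial Literature.Computability.Complexity
  Literature.Computability.Complexity.CodeFP Literature.Computability.Complexity.Brick
  Literature.LinearAlgebra.Matrix Literature.LinearAlgebra.Matrix.RowSelect
  Literature.Computability.Complexity.RowSelectFP Literature.Algebra.EuclideanLattices GIVPPost

/-! ### The scale, the radius index, the radius -/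

/-- The largest squared norm of the LLL basis (`λ̃ₙ²` in Regev's notation, for the machine's LLL output).
[cite: Regev2009, Lemma 3.17 (proof)] -/
def maxSq (I : LatticeInstance) : ℤ := maxNormSq (basisRows (SimApproxLLL.lllOut I))

/-- **The exponent of the scale** `R = 2ᵏ`: `k = ⌈|bin M| / 2⌉`, `M` the largest squared norm.
[cite: Regev2009, Lemma 3.17 (proof: the scale λ̃ₙ of the radii)] -/
def radiusExp (I : LatticeInstance) : ℕ := ((maxSq I).toNat.size + 1) / 2

/-- **The radius index of a copy**: the position `j` of the `1` of its one-hot index, divided by `n²`.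
[cite: Regev2009, Lemma 3.17 (proof: n² calls per radius)] -/
def radiusIdx (I : LatticeInstance) (e : List Bool) : ℕ := leadingZeros e / (I.n * I.n)

/-- The reduced fraction of `2ᵏ / 2ⁱ`: `(2^{k-i}, 1)` or `(1, 2^{i-k})`. [folklore] -/
def radiusFrac (k i : ℕ) : ℤ × ℕ := if i ≤ k then ((2 : ℤ) ^ (k - i), 1) else (1, 2 ^ (i - k))

/-- **The radius of a copy**: `rᵢ = 2ᵏ / 2ⁱ`. [cite: Regev2009, Lemma 3.17 (proof: rᵢ = λ̃ₙ 2⁻ⁱ)] -/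
def radius (I : LatticeInstance) (e : List Bool) : ℚ := (2 : ℚ) ^ radiusExp I / (2 : ℚ) ^ radiusIdx I e

/-- **The query string**: the code of the `DGS` instance `(B, rᵢ)`. [cite: Regev2009, Lemma 3.17 (proof)] -/
def queryStr (p : LatticeInstance × List Bool) : List Bool := GapSVPInstance.encode (p.1, radius p.1 p.2)

/-- `2ᵏ / 2ⁱ` as a power of two or its inverse. [folklore] -/
theorem two_pow_div_two_pow (k i : ℕ) :
    (2 : ℚ) ^ k / (2 : ℚ) ^ i = if i ≤ k then ((2 : ℚ) ^ (k - i)) else ((2 : ℚ) ^ (i - k))⁻¹ := by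
  split_ifs with h
  · rw [div_eq_iff (by positivity), ← pow_add, Nat.sub_add_cancel h]
  · have h2 : (2 : ℚ) ^ i = 2 ^ k * 2 ^ (i - k) := by
      rw [← pow_add, Nat.add_sub_cancel' (le_of_lt (not_le.1 h))]
    rw [h2, div_mul_eq_div_div, div_self (pow_ne_zero _ two_ne_zero), one_div]

/-- **The reduced fraction of the radius.** [folklore] -/
theorem radiusFrac_eq (k i : ℕ) :
    radiusFrac k i = (((2 : ℚ) ^ k / (2 : ℚ) ^ i).num, ((2 : ℚ) ^ k / (2 : ℚ) ^ i).den) := by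
  rw [two_pow_div_two_pow, radiusFrac]
  split_ifs with h
  · have h1 : ((2 : ℚ) ^ (k - i)) = ((2 ^ (k - i) : ℤ) : ℚ) := by push_cast; rfl
    rw [h1, Rat.num_intCast, Rat.den_intCast]
  · have h1 : ((2 : ℚ) ^ (i - k)) = ((2 ^ (i - k) : ℕ) : ℚ) := by push_cast; rfl
    rw [h1, Rat.inv_natCast_num_of_pos (by positivity), Rat.inv_natCast_den_of_pos (by positivity)]

/-- The numerator and denominator of the radius. [folklore] -/
theorem radius_num_den (I : LatticeInstance) (e : List Bool) :
    ((radius I e).num, (radius I e).den) = radiusFrac (radiusExp I) (radiusIdx I e) := by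
  rw [radius, radiusFrac_eq]

/-- **The scale brackets the largest squared norm**: `M < 4ᵏ` (`λ̃ₙ < 2ᵏ`). [cite: Regev2009, Lemma 3.17 (proof)] -/
theorem lt_four_pow_radiusExp (I : LatticeInstance) : (maxSq I).toNat < 4 ^ radiusExp I := by
  rw [radiusExp, show (4 : ℕ) = 2 ^ 2 by norm_num, ← pow_mul]
  refine lt_of_lt_of_le (Nat.lt_size_self _) (Nat.pow_le_pow_right (by norm_num) ?_)
  omega

/-- **The scale brackets the largest squared norm**: `4^{k-1} ≤ M` when `M ≥ 1` (`2ᵏ ≤ 2 λ̃ₙ`).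
[cite: Regev2009, Lemma 3.17 (proof)] -/
theorem four_pow_radiusExp_sub_one_le {I : LatticeInstance} (h : 1 ≤ (maxSq I).toNat) :
    4 ^ (radiusExp I - 1) ≤ (maxSq I).toNat := by
  rw [radiusExp, show (4 : ℕ) = 2 ^ 2 by norm_num, ← pow_mul]
  have hs : 0 < (maxSq I).toNat.size := Nat.size_pos.2 h
  apply Nat.lt_size.1
  omega

/-! ### The query map on codes -/

/-- Lattice instances by their tree code. [folklore] -/
local notation "instE" => GIVPPost.instE

/-- The position of the first `1`, in unary (`zerosPrefixFn`). [cite: AroraBarak2009, §1.3] -/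
theorem leadingZeros_codeFP : CodeFP strE unE leadingZeros :=
  ⟨zerosPrefixFn, zerosPrefixFn_mem_FP, fun w => by rw [zerosPrefixFn, unE_eq_ones]; rfl⟩

/-- **The largest squared norm of the LLL basis on codes.** [cite: Regev2009, Lemma 3.17 (proof)] -/
theorem maxSq_codeFP : CodeFP instE intE maxSq := (maxNormSq_codeFP.comp lllRows_codeFP).congr fun _ => rfl

/-- **The exponent of the scale on codes** (`|bin M|` read as the length of the numeral).
[cite: AroraBarak2009, §1.3] -/
theorem radiusExp_codeFP : CodeFP instE natE radiusExp := by
  have hM : CodeFP instE natE (fun I => (maxSq I).toNat) := (intToNat.comp maxSq_codeFP).congr fun _ => rfl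
  have hL : CodeFP instE natE (fun I => (natE (maxSq I).toNat).length) := (strNatLength.comp (strOfNat.comp hM)).congr fun _ => rfl
  refine ((natDiv.comp ((natAdd.comp (hL.pair (const _ 1))).pair (const _ 2))).congr fun I => ?_)
  rw [radiusExp, IntDetFP.length_natE_eq_size]

/-- The exponent of the scale in unary (it is at most the length of the numeral of `M`). [folklore] -/
theorem radiusExpUn_codeFP : CodeFP instE unE radiusExp := by
  have hM : CodeFP instE natE (fun I => (maxSq I).toNat) := (intToNat.comp maxSq_codeFP).congr fun _ => rfl
  have hLu : CodeFP instE unE (fun I => (natE (maxSq I).toNat).length) := (strLength.comp (strOfNat.comp hM)).congr fun _ => rfl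
  refine ((unOfNatMin.comp (hLu.pair radiusExp_codeFP)).congr fun I => ?_)
  rw [radiusExp, IntDetFP.length_natE_eq_size]
  apply min_eq_left
  omega

/-- **The radius index on codes.** [cite: AroraBarak2009, §1.3] -/
theorem radiusIdx_codeFP : CodeFP (pairE instE strE) natE (fun p => radiusIdx p.1 p.2) := by
  have hn : CodeFP (pairE instE strE) natE (fun p => p.1.n) := (dim_codeFP.comp (fst _ _)).congr fun _ => rfl
  have hj : CodeFP (pairE instE strE) natE (fun p => leadingZeros p.2) := (natOfUn.comp (leadingZeros_codeFP.comp (snd _ _))).congr fun _ => rfl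
  exact (natDiv.comp (hj.pair (natMul.comp (hn.pair hn)))).congr fun _ => rfl

/-- The radius index in unary (it is at most the position of the `1`). [folklore] -/
theorem radiusIdxUn_codeFP : CodeFP (pairE instE strE) unE (fun p => radiusIdx p.1 p.2) := by
  have hju : CodeFP (pairE instE strE) unE (fun p => leadingZeros p.2) := leadingZeros_codeFP.comp (snd _ _)
  refine ((unOfNatMin.comp (hju.pair radiusIdx_codeFP)).congr fun p => ?_)
  exact min_eq_left (Nat.div_le_self _ _)

/-- **The reduced fraction of the radius on codes** (powers with unary exponents). [cite: AroraBarak2009, §1.3] -/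
theorem radiusFrac_codeFP : CodeFP (pairE instE strE) (pairE intE natE) (fun p => radiusFrac (radiusExp p.1) (radiusIdx p.1 p.2)) := by
  let iE := pairE GIVPPost.instE strE
  have hk : CodeFP iE natE (fun p => radiusExp p.1) := radiusExp_codeFP.comp (fst _ _)
  have hku : CodeFP iE unE (fun p => radiusExp p.1) := radiusExpUn_codeFP.comp (fst _ _)
  have hi : CodeFP iE natE (fun p => radiusIdx p.1 p.2) := radiusIdx_codeFP
  have hiu : CodeFP iE unE (fun p => radiusIdx p.1 p.2) := radiusIdxUn_codeFP
  have hle : CodeFP iE bitE (fun p => decide (radiusIdx p.1 p.2 ≤ radiusExp p.1)) := natLe.comp (hi.pair hk)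
  -- `k - i ≤ k` and `i - k ≤ i`: unary exponents under those caps
  have hki : CodeFP iE unE (fun p => min (radiusExp p.1 - radiusIdx p.1 p.2) (radiusExp p.1)) :=
    (unOfNatMin.comp (hku.pair (natSub.comp (hk.pair hi)))).congr fun _ => rfl
  have hik : CodeFP iE unE (fun p => min (radiusIdx p.1 p.2 - radiusExp p.1) (radiusIdx p.1 p.2)) :=
    (unOfNatMin.comp (hiu.pair (natSub.comp (hi.pair hk)))).congr fun _ => rfl
  have hpow1 : CodeFP iE natE (fun p => 2 ^ min (radiusExp p.1 - radiusIdx p.1 p.2) (radiusExp p.1)) :=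
    (natPow.comp ((const _ 2).pair hki)).congr fun _ => rfl
  have hpow2 : CodeFP iE natE (fun p => 2 ^ min (radiusIdx p.1 p.2 - radiusExp p.1) (radiusIdx p.1 p.2)) :=
    (natPow.comp ((const _ 2).pair hik)).congr fun _ => rfl
  have hbr1 : CodeFP iE (pairE intE natE) (fun p => (((2 ^ min (radiusExp p.1 - radiusIdx p.1 p.2) (radiusExp p.1) : ℕ) : ℤ), (1 : ℕ))) :=
    (intOfNat.comp hpow1).pair (const _ 1)
  have hbr2 : CodeFP iE (pairE intE natE) (fun p => ((1 : ℤ), 2 ^ min (radiusIdx p.1 p.2 - radiusExp p.1) (radiusIdx p.1 p.2))) :=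
    (const _ (1 : ℤ)).pair hpow2
  refine (hle.ite hbr1 hbr2).congr fun p => ?_
  rw [radiusFrac, min_eq_left (Nat.sub_le _ _), min_eq_left (Nat.sub_le _ _)]
  by_cases h : radiusIdx p.1 p.2 ≤ radiusExp p.1
  · rw [if_pos (decide_eq_true h), if_pos h]; push_cast; rfl
  · rw [if_neg (by rw [decide_eq_true_iff]; exact h), if_neg h]

/-- **The query map of Regev's `GIVP ≤ DGS` machine is ONE polynomial-time string function**:
`⟨encode I, e⟩ ↦ GapSVPInstance.encode (I, 2ᵏ/2ⁱ)`. [cite: Regev2009, Lemma 3.17 (proof)] [cite: AroraBarak2009, §1.3] -/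
theorem queryStr_codeFP : CodeFP (pairE instE strE) strE queryStr := by
  have hfrac := radiusFrac_codeFP
  have hsm : CodeFP (pairE GIVPPost.instE strE) (pairE smE natE) (fun p => radiusFrac (radiusExp p.1) (radiusIdx p.1 p.2)) :=
    ((smOfInt.comp hfrac.fst').pair hfrac.snd').congr fun _ => rfl
  refine ((fst GIVPPost.instE strE).pair hsm).recodeOut fun p => ?_
  rw [← radius_num_den]
  rfl

/-- **The query map as an `FP` string function on `⟨encode I, e⟩`.** [cite: Regev2009, Lemma 3.17 (proof)] -/
theorem exists_queryFn : ∃ h : List Bool → List Bool, h ∈ FP ∧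
    ∀ (I : LatticeInstance) (e : List Bool), h (boolPair I.encode e) = GapSVPInstance.encode (I, radius I e) := by
  obtain ⟨h, hh, hspec⟩ := queryStr_codeFP
  exact ⟨h, hh, fun I e => hspec (I, e)⟩

/-! ### The one-hot index -/

/-- The one-hot word `e_j ∈ {0,1}^K` (as fed to the copies: `PolyCopiesIdx.inputIdx`). [folklore] -/
def oneHot (K j : ℕ) : List Bool := List.ofFn fun j' : Fin K => decide ((j' : ℕ) = j)

/-- `e_j = 0ʲ 1 0^{K-1-j}` for `j < K`. [folklore] -/
theorem oneHot_eq {K j : ℕ} (hj : j < K) :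
    oneHot K j = List.replicate j false ++ true :: List.replicate (K - 1 - j) false := by
  apply List.ext_getElem
  · simp [oneHot]; omega
  · intro i h₁ h₂
    simp only [oneHot, List.getElem_ofFn]
    rcases lt_trichotomy i j with h | rfl | h
    · rw [List.getElem_append_left (by simpa using h)]
      simp [h.ne]
    · rw [List.getElem_append_right (by simp)]
      simp
    · rw [List.getElem_append_right (by simp; omega)]
      have : i - (List.replicate j false).length = (i - j - 1) + 1 := by simp; omega
      simp only [this, List.getElem_cons_succ, List.getElem_replicate]
      simp [h.ne']

/-- **The index is read correctly**: `leadingZeros e_j = j` for `j < K`. [folklore] -/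
theorem leadingZeros_oneHot {K j : ℕ} (hj : j < K) : leadingZeros (oneHot K j) = j := by
  rw [oneHot_eq hj, leadingZeros_replicate_append]

/-- Hence the radius index of copy `j` is `j / n²`. [cite: Regev2009, Lemma 3.17 (proof)] -/
theorem radiusIdx_oneHot (I : LatticeInstance) {K j : ℕ} (hj : j < K) : radiusIdx I (oneHot K j) = j / (I.n * I.n) := by
  rw [radiusIdx, leadingZeros_oneHot hj]

end Regev2009.GIVPQuery

end Literature.Computability.Cryptography

end
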